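import Literature.AnabelianGeometry.EtaleTheta.SettingModelCyclotomicCharacterPadicSurjective
import HarnessLib

/-!
# The `p`-adic cyclotomic character `χ_p : G_{ℚ_p} → ℤ_p^×` is CONTINUOUS (hence a continuous surjection of
# profinite groups; proof-only)

J.-P. Serre, *Local Fields*, IV §4 Prop. 17/18 (`Gal(ℚ_p(ζ_{p^∞})/ℚ_p) ≅ ℤ_p^×`) [cite: SerreLocalFields1979, IV §4 Prop 17];
J. Neukirch, *Algebraic Number Theory*, Ch. IV §1 (Krull topology) [cite: NeukirchANT1999, Ch. IV §1];
S. Mochizuki, [EtTh] §1 p. 12 "`Δ_Θ (≅ Ẑ(1))`" [cite: MochizukiEtTh2009, §1 p.12].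

abc-iut cell, layer L2, seat abc-iut-w5-d091 (gen 5); χ-lineage (R78 F3), F3 addendum 6.  PROOF-ONLY (no definition, no
instance, no named fact).  F3 proved that every level `σ ↦ χ_{N}(σ)` is LOCALLY CONSTANT on `G_{ℚ_p}`
(`isLocallyConstant_levelChar_chi`); F3 addendum 5 proved `χ_p : G_{ℚ_p} ↠ ℤ_p^×` (`padicCharUnits_comp_chi_surjective`).
Here: the glued character is continuous for the `p`-adic topology, so `χ_p` is a CONTINUOUS SURJECTIVE homomorphism of
compact groups `G_{ℚ_p} ↠ ℤ_p^×` with closed kernel (`= G_{ℚ_p(μ_{p^∞})}`).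

* **`continuous_padicChar_chi : Continuous (fun σ => padicChar p (χ σ))`** — a map into `ℤ_p` all of whose reductions
  `mod pᵏ` are locally constant is continuous (`‖x‖ ≤ p^{-k} ↔ x ∈ (pᵏ) = Ker(ℤ_p → ℤ/pᵏ)`);
* `continuous_padicCharUnits_comp_chi` — continuity into the units `ℤ_p^×` (product-embedding topology);
* `isClosed_ker_padicCharUnits_comp_chi` — the kernel is a closed (normal) subgroup of `G_{ℚ_p}`;
* `mem_ker_padicCharUnits_comp_chi_iff` (`σ ∈ Ker χ_p ↔ ∀ k, χ_{pᵏ}(σ) = 1`) and `isClosed_image_padicChar_chi` — the image of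
  any closed subset of `G_{ℚ_p}` under `χ_p` is compact, hence closed, in `ℤ_p`.
Classical; nothing of [EtTh] is asserted; no side is taken on [IUTchIII] Cor. 3.12; a model is consistency evidence only.
-/

noncomputable section

open CategoryTheory ProfiniteGrp ProfiniteGrp.ProfiniteCompletion

namespace Literature.AnabelianGeometry.EtaleTheta.SettingModel

open Literature.AnabelianGeometry.SemiGraphs

variable (p : ℕ) [hp : Fact p.Prime]

/-- Two `p`-adic integers with the same reduction `mod pᵏ` are within `p^{-k}`. [folklore] -/
private theorem norm_sub_le_of_toZModPow_eq {x y : ℤ_[p]} {k : ℕ}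
    (h : PadicInt.toZModPow k x = PadicInt.toZModPow k y) : ‖x - y‖ ≤ (p : ℝ) ^ (-k : ℤ) := by
  rw [PadicInt.norm_le_pow_iff_mem_span_pow, ← PadicInt.ker_toZModPow, RingHom.mem_ker, map_sub, h, sub_self]

/-- **The `p`-adic cyclotomic character `σ ↦ χ_p(σ) ∈ ℤ_p` is continuous on `G_{ℚ_p}`** (Krull topology on `G_{ℚ_p}`,
`p`-adic topology on `ℤ_p`): near `σ₀` the open set `{χ_{pᵏ}(σ) = χ_{pᵏ}(σ₀)}` (F3) is mapped into the ball of radius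
`p^{-k}` about `χ_p(σ₀)`. [cite: NeukirchANT1999, Ch. IV §1] -/
theorem continuous_padicChar_chi : Continuous fun σ : GQp p => ZHatLevel.padicChar p (chi p σ) := by
  rw [continuous_def]
  intro U hU
  rw [isOpen_iff_forall_mem_open]
  intro σ₀ hσ₀
  rw [Set.mem_preimage] at hσ₀
  obtain ⟨ε, hε, hball⟩ := Metric.isOpen_iff.mp hU _ hσ₀
  -- a level `k` with `p^{-k} < ε`
  have hp1 : ((p : ℝ)⁻¹) < 1 := inv_lt_one_of_one_lt₀ (by exact_mod_cast hp.out.one_lt)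
  obtain ⟨k, hk⟩ := exists_pow_lt_of_lt_one hε hp1
  refine ⟨{σ | ZHatLevel.levelChar (ZHatLevel.ppow p k) (chi p σ) =
      ZHatLevel.levelChar (ZHatLevel.ppow p k) (chi p σ₀)}, ?_, isOpen_setOf_levelChar_chi_eq p _ _, rfl⟩
  intro σ hσ
  rw [Set.mem_preimage]
  apply hball
  rw [Metric.mem_ball, dist_eq_norm]
  have hred : PadicInt.toZModPow k (ZHatLevel.padicChar p (chi p σ)) =
      PadicInt.toZModPow k (ZHatLevel.padicChar p (chi p σ₀)) := by
    rw [toZModPow_padicChar_chi, toZModPow_padicChar_chi]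
    exact hσ
  refine lt_of_le_of_lt (norm_sub_le_of_toZModPow_eq p hred) ?_
  rwa [zpow_neg, zpow_natCast, ← inv_pow]

/-- Continuity as a function of the form `padicChar ∘ chi`. [cite: NeukirchANT1999, Ch. IV §1] -/
theorem continuous_padicChar_comp_chi : Continuous ((ZHatLevel.padicChar p).comp (chi p)) :=
  continuous_padicChar_chi p

/-- **`χ_p : G_{ℚ_p} → ℤ_p^×` is continuous** (units with Mathlib's product-embedding topology: both `χ_p(σ)` and
`χ_p(σ)⁻¹ = χ_p(σ⁻¹)` vary continuously). [cite: NeukirchANT1999, Ch. IV §1] -/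
theorem continuous_padicCharUnits_comp_chi : Continuous ((ZHatLevel.padicCharUnits p).comp (chi p)) := by
  refine Units.continuous_iff.mpr ⟨?_, ?_⟩
  · exact continuous_padicChar_chi p
  · have h : (fun σ : GQp p => (((((ZHatLevel.padicCharUnits p).comp (chi p)) σ)⁻¹ : ℤ_[p]ˣ) : ℤ_[p])) =
        fun σ => ZHatLevel.padicChar p (chi p σ⁻¹) := by
      funext σ
      rw [← map_inv, MonoidHom.comp_apply, ZHatLevel.coe_padicCharUnits]
    rw [h]
    exact (continuous_padicChar_chi p).comp continuous_inv

/-- **`χ_p` is a CONTINUOUS SURJECTION `G_{ℚ_p} ↠ ℤ_p^×`** (F3 addendum 5 + continuity).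
[cite: SerreLocalFields1979, IV §4 Prop 17] -/
theorem continuous_and_surjective_padicCharUnits_comp_chi :
    Continuous ((ZHatLevel.padicCharUnits p).comp (chi p)) ∧
      Function.Surjective ((ZHatLevel.padicCharUnits p).comp (chi p)) :=
  ⟨continuous_padicCharUnits_comp_chi p, padicCharUnits_comp_chi_surjective p⟩

/-- The kernel of `χ_p` — the subgroup `G_{ℚ_p(μ_{p^∞})}` of `σ` fixing all `p`-power roots of unity — is CLOSED in
`G_{ℚ_p}`. [cite: NeukirchANT1999, Ch. IV §1] -/
theorem isClosed_ker_padicCharUnits_comp_chi :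
    IsClosed ((((ZHatLevel.padicCharUnits p).comp (chi p)).ker : Subgroup (GQp p)) : Set (GQp p)) := by
  have h : ((((ZHatLevel.padicCharUnits p).comp (chi p)).ker : Subgroup (GQp p)) : Set (GQp p)) =
      (fun σ : GQp p => ZHatLevel.padicChar p (chi p σ)) ⁻¹' {1} := by
    ext σ
    rw [SetLike.mem_coe, MonoidHom.mem_ker, Set.mem_preimage, Set.mem_singleton_iff, ← Units.val_eq_one,
      MonoidHom.comp_apply, ZHatLevel.coe_padicCharUnits]
  rw [h]
  exact isClosed_singleton.preimage (continuous_padicChar_chi p)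

/-- `σ ∈ Ker χ_p` iff `χ_{pᵏ}(σ) = 1` for every `k` (iff `σ` fixes every `p`-power root of unity, by F3 addendum 3's
`apply_eq_self_of_levelChar_chi_eq_one`). [cite: SerreLocalFields1979, IV §4 Prop 17] -/
theorem mem_ker_padicCharUnits_comp_chi_iff (σ : GQp p) :
    σ ∈ ((ZHatLevel.padicCharUnits p).comp (chi p)).ker ↔
      ∀ k : ℕ, ZHatLevel.levelChar (ZHatLevel.ppow p k) (chi p σ) = 1 := by
  rw [MonoidHom.mem_ker, ← Units.val_eq_one, MonoidHom.comp_apply, ZHatLevel.coe_padicCharUnits,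
    ← PadicInt.ext_of_toZModPow]
  refine forall_congr' fun k => ?_
  rw [toZModPow_padicChar_chi, map_one]
  haveI : NeZero (p ^ k) := ⟨pow_ne_zero k hp.out.ne_zero⟩
  exact Iff.rfl

/-- The image under `χ_p` of a closed subset of `G_{ℚ_p}` is compact, hence closed, in `ℤ_p` (e.g. `χ_p(U)` for an
open subgroup `U = G_K`, `K/ℚ_p` finite). [cite: NeukirchANT1999, Ch. IV §1] -/
theorem isClosed_image_padicChar_chi {S : Set (GQp p)} (hS : IsClosed S) :
    IsClosed ((fun σ : GQp p => ZHatLevel.padicChar p (chi p σ)) '' S) := by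
  haveI : IsGalois ℚ_[p] (PadicAlgCl p) := {}
  exact (hS.isCompact.image (continuous_padicChar_chi p)).isClosed

end Literature.AnabelianGeometry.EtaleTheta.SettingModel

end
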